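import Mathlib
import Summits.BirchSwinnertonDyer.BirchSwinnertonDyer.Theorems.ManinLocalTwoThreeOddDegreeForcesQuarterSymbol
import Summits.BirchSwinnertonDyer.BirchSwinnertonDyer.Theorems.ManinLocalTwoThreeCuspThreeTorsionAtFour
import Literature.NumberTheory.EllipticCurves.ModularSymbolsHeckeProofs
import HarnessLib

/-!
# Odd modular degree at `N = 4p` ⟹ `3{∞,0}_f ∉ Λ_f` (half of THEOREM C, E-an-84) ⟹ `L(f, 1) ≠ 0`

Summit `BirchSwinnertonDyer`, sub-problem `BirchSwinnertonDyer`, route `ManinLocalTwoThree`; width seat `bsd-line-manin23-p2`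
(gen 9), `--supports` the crux C2 `ManinOddAtFour` (stmt-BirchSwinnertonDyer-22967).  Cell `bsd-f2-manin`, an lens (MEMO-an §60.5,
leaf `…ManinAdditive.HalfTranslationParity`, row E-an-84 `FourPCuspZeroParity` = THEOREM C «`deg φ` odd ⟺ `3{∞,0}_f ∉ Λ_f` …
and `L(E₀,1) ≠ 0` for every odd-degree one»).  The tree has THEOREM B (the cusp hexagon, `fourPCuspHexagon_holds`) and now the
seat's `two_dvd_deg_of_quarterSymbol_mem` (p658678); together they give the FORWARD half of THEOREM C for EVERY datum at
`N = 4p` (no optimality): `3{∞,0} − {∞,¼} ∈ Λ_f` (hexagon arithmetic), so `3{∞,0} ∈ Λ_f ⟹ {∞,¼} ∈ Λ_f ⟹ 2 ∣ deg φ`.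
Consequently an odd-degree parametrisation at conductor `4p` has `{∞, 0}_f ≠ 0`, i.e. `L(f, 1) ≠ 0` (`modularSymbol_zero_eq`).

PROVED here (no `sorry`): `three_mul_cuspZero_sub_quarter_mem` (hexagon arithmetic), **`three_mul_cuspZeroSymbol_not_mem_of_odd_deg`**,
**`modularSymbol_zero_ne_zero_of_odd_deg`**, **`lValue_one_ne_zero_of_odd_deg`** (for every entire continuation `L` of `L(f,s)`).
BSD is not proved by this; Manin's conjecture is not proved by this.
-/

set_option autoImplicit false
set_option linter.dupNamespace false

noncomputable section

open scoped MatrixGroups ModularForm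
open CongruenceSubgroup
open Literature.NumberTheory.EllipticCurves Literature.NumberTheory.EllipticCurves.ModularForms
open Summit.BirchSwinnertonDyer.Rank1Residual.ManinAdditive

namespace Summit.BirchSwinnertonDyer.BirchSwinnertonDyer.Theorems.ManinLocalTwoThree

/-- Hexagon arithmetic at `N = 4p`: `3{∞,0}_f − {∞,¼}_f ∈ Λ_f`
(`= 3({∞,0} − {∞,¼} − {∞,1/p}) + 2{∞,¼} + 3{∞,1/p}`). -/
theorem three_mul_cuspZero_sub_quarter_mem {W : WeierstrassCurve ℚ} [W.IsElliptic] {p : ℕ} [NeZero (4 * p)]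
    (hp : p.Prime) (hp2 : p ≠ 2) (D : ModularParametrizationData W (4 * p)) :
    (3 : ℂ) * modularSymbol D.f 0 - modularSymbol D.f (1 / 4 : ℚ) ∈ periodLattice D.f := by
  obtain ⟨h2, h3, h0, -, -⟩ := fourPCuspHexagon_holds W D p hp hp2 rfl
  have h0' := (periodLattice D.f).nsmul_mem h0 3
  have := (periodLattice D.f).add_mem ((periodLattice D.f).add_mem h0' h2) h3
  convert this using 1
  simp only [nsmul_eq_mul, Nat.cast_ofNat]
  ring

/-- **Forward half of THEOREM C (E-an-84), for every datum at `N = 4p`:** `Odd (deg φ) ⟹ 3{∞,0}_f ∉ Λ_f`. -/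
theorem three_mul_cuspZeroSymbol_not_mem_of_odd_deg {W : WeierstrassCurve ℚ} [W.IsElliptic] {p : ℕ} [NeZero (4 * p)]
    (hp : p.Prime) (hp2 : p ≠ 2) (D : ModularParametrizationData W (4 * p)) (hodd : Odd D.deg) :
    (3 : ℂ) * modularSymbol D.f 0 ∉ periodLattice D.f := by
  intro h3in
  have hq : modularSymbol D.f (1 / 4 : ℚ) ∈ periodLattice D.f := by
    simpa using (periodLattice D.f).sub_mem h3in (three_mul_cuspZero_sub_quarter_mem hp hp2 D)
  exact quarterSymbol_not_mem_of_odd_deg (hp.odd_of_ne_two hp2) hp.one_lt.ne' D hodd hq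

/-- **`{∞, 0}_f ≠ 0` for an odd-degree parametrisation at `N = 4p`.** -/
theorem modularSymbol_zero_ne_zero_of_odd_deg {W : WeierstrassCurve ℚ} [W.IsElliptic] {p : ℕ} [NeZero (4 * p)]
    (hp : p.Prime) (hp2 : p ≠ 2) (D : ModularParametrizationData W (4 * p)) (hodd : Odd D.deg) :
    modularSymbol D.f 0 ≠ 0 := fun h0 =>
  three_mul_cuspZeroSymbol_not_mem_of_odd_deg hp hp2 D hodd (by rw [h0, mul_zero]; exact (periodLattice D.f).zero_mem)

/-- **`L(f, 1) ≠ 0` for an odd-degree parametrisation at `N = 4p`** — for every entire continuation `L` of the `L`-series of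
`f` (`{∞,0}_f = L(1)`, `modularSymbol_zero_eq`). -/
theorem lValue_one_ne_zero_of_odd_deg {W : WeierstrassCurve ℚ} [W.IsElliptic] {p : ℕ} [NeZero (4 * p)]
    (hp : p.Prime) (hp2 : p ≠ 2) (D : ModularParametrizationData W (4 * p)) (hodd : Odd D.deg)
    {L : ℂ → ℂ} (hL : Differentiable ℂ L) (hL' : ∀ s : ℂ, 2 < s.re → L s = cuspFormLSeries D.f s) : L 1 ≠ 0 := by
  rw [← modularSymbol_zero_eq_holds D.f hL hL']
  exact modularSymbol_zero_ne_zero_of_odd_deg hp hp2 D hodd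

end Summit.BirchSwinnertonDyer.BirchSwinnertonDyer.Theorems.ManinLocalTwoThree

end
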